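import Mathlib
import Summits.AtomisticToContinuum.Crystallization.Theorems.ExcessDecayLiouvillePhononStabilityCertPolyA

/-!
# Polynomial Gram data, the cell certificate and its check

Support file for the crux `PhononStability` (line contragredient-window-collapse), namespace
`…PhononStabilityCWC.Cert`.
-/

noncomputable section

open scoped BigOperators Classical InnerProductSpace
open Filter Set Function
open Summit.AtomisticToContinuum.Crystallization.Theorems.PhononStabilityNegative

namespace Summit.AtomisticToContinuum.Crystallization.Theorems.PhononStabilityCWC.Cert

local notation "E3" => EuclideanSpace ℝ (Fin 3)

/-! ## Gram data with a polynomial basis -/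

/-- A Gram datum with a POLYNOMIAL basis: monomial values are `μ_a = p_a(x)` for scalar polynomials `p_a` in the chart
variables (index `0` is conventionally the constant `1`, but any list is sound). -/
structure GramB where
  /-- the factor data -/
  G : GramP
  /-- the basis polynomials -/
  basis : List SPoly

namespace GramB

variable (B : GramB)

/-- the basis polynomial of index `a` (default: the constant `1`) -/
def bpoly (a : Fin B.G.nmono) : SPoly := B.basis.getD a.val [([], 1)]

/-- the polynomial pair form of the Gram datum: `Σ_{a,b} p_a p_b · table(a, b)` -/
def ppf : PolyPF :=
  let nz := B.G.nzTab
  (List.finRange B.G.nmono).flatMap fun a => (List.finRange B.G.nmono).flatMap fun b =>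
    mulSP (spMulN (B.bpoly a) (B.bpoly b)) [([], B.G.table nz a b)]

/-- evaluation of a Gram datum with a polynomial basis. [folklore] -/
theorem evalPPF_eq {w : Label → E3} (hw : (support w).Finite) (x : ℕ → ℝ) :
    evalPPF B.ppf x w = B.G.eval (fun a => spEval (B.bpoly a) x) w := by
  rw [B.G.eval_eq_table hw]
  unfold ppf
  rw [evalPPF_flatMap, ← List.ofFn_eq_map, List.sum_ofFn]
  refine Finset.sum_congr rfl fun a _ => ?_
  rw [evalPPF_flatMap, ← List.ofFn_eq_map, List.sum_ofFn]
  refine Finset.sum_congr rfl fun b _ => ?_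
  rw [evalPPF_mulSP, spEval_spMulN]
  simp [evalPPF, monoVal]

/-- Gram data with a polynomial basis evaluate nonnegatively. [folklore] -/
theorem evalPPF_nonneg (h : B.G.weightsOK = true) {w : Label → E3} (hw : (support w).Finite) (x : ℕ → ℝ) :
    0 ≤ evalPPF B.ppf x w := by
  rw [B.evalPPF_eq hw]; exact B.G.eval_nonneg h _ _

end GramB

/-! ## Gram evaluation with slot-pair accumulation (the same form, far fewer table entries) -/

/-- merge adjacent `(monomial, matrix)` entries with equal monomials by adding the matrices (materialised) -/
def pmMergeAdj : List (Mono × Mat) → List (Mono × Mat)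
  | [] => []
  | [e] => [e]
  | e :: f :: rest =>
      if e.1 = f.1 then pmMergeAdj ((e.1, (M9.addMat e.2 f.2).get) :: rest) else e :: pmMergeAdj (f :: rest)
  termination_by L => L.length

/-- group `(monomial, matrix)` entries by monomial (`O(n log n)`) -/
def pmGroup (L : List (Mono × Mat)) : List (Mono × Mat) := pmMergeAdj (L.mergeSort fun a b => monoLE a.1 b.1)

/-- grouping preserves every `matrix-additive` weighted evaluation. [folklore] -/
theorem sum_pmMergeAdj (φ : Mat → ℝ) (hφ : ∀ M N : Mat, φ (fun c d => M c d + N c d) = φ M + φ N) (x : ℕ → ℝ)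
    (L : List (Mono × Mat)) :
    ((pmMergeAdj L).map fun e => monoVal x e.1 * φ e.2).sum = (L.map fun e => monoVal x e.1 * φ e.2).sum := by
  induction hn : L.length using Nat.strong_induction_on generalizing L with
  | _ n ih =>
    match L, hn with
    | [], _ => simp [pmMergeAdj]
    | [e], _ => simp [pmMergeAdj]
    | e :: f :: rest, hn =>
        rw [pmMergeAdj]
        split_ifs with h
        · rw [ih _ (by simp at hn ⊢; omega) _ rfl, List.map_cons, List.map_cons, List.map_cons, List.sum_cons,
            List.sum_cons, List.sum_cons, M9.get_addMat, hφ]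
          obtain ⟨me, Me⟩ := e
          obtain ⟨mf, Mf⟩ := f
          simp only at h
          subst h
          ring
        · rw [List.map_cons, List.map_cons, List.sum_cons, List.sum_cons, ih _ (by simp at hn ⊢; omega) _ rfl,
            List.map_cons, List.sum_cons]

/-- grouping preserves every matrix-additive weighted evaluation. [folklore] -/
theorem sum_pmGroup (φ : Mat → ℝ) (hφ : ∀ M N : Mat, φ (fun c d => M c d + N c d) = φ M + φ N) (x : ℕ → ℝ)
    (L : List (Mono × Mat)) :
    ((pmGroup L).map fun e => monoVal x e.1 * φ e.2).sum = (L.map fun e => monoVal x e.1 * φ e.2).sum := by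
  unfold pmGroup
  rw [sum_pmMergeAdj φ hφ]
  exact ((List.mergeSort_perm _ _).map _).sum_eq

/-- sum of a flat-mapped list of reals. [folklore] -/
theorem sum_flatMap' {α : Type*} (l : List α) (h : α → List ℝ) : (l.flatMap h).sum = (l.map fun a => (h a).sum).sum := by
  induction l with
  | nil => rfl
  | cons a rest ih => rw [List.flatMap_cons, List.sum_append, ih, List.map_cons, List.sum_cons]

namespace GramB

variable (B : GramB)

/-- all basis-pair contributions to the slot pair `(i, j)`: `(monomial, coefficient • block)` -/
def slotPoly (nz : Array (Array Bool)) (i j : Fin B.G.S) : List (Mono × Mat) :=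
  (List.finRange B.G.nmono).flatMap fun a => (List.finRange B.G.nmono).flatMap fun b =>
    if B.G.nzGet nz a i && B.G.nzGet nz b j then
      let Q := (M9.ofMat (B.G.blockPair a b i j)).get
      if GramP.matIsZero Q then [] else (spMulN (B.bpoly a) (B.bpoly b)).map fun e => (e.1, fun c d => e.2 * Q c d)
    else []

/-- **the polynomial pair form of the Gram datum, accumulated per slot pair** (same evaluation as `ppf`). -/
def ppf2 : PolyPF :=
  let nz := B.G.nzTab
  (List.finRange B.G.S).flatMap fun i => (List.finRange B.G.S).flatMap fun j =>
    (pmGroup (B.slotPoly nz i j)).map fun e => (e.1, B.G.crossTable e.2 i j)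

/-- evaluation of the accumulated form. [folklore] -/
theorem evalPPF_ppf2 {w : Label → E3} (hw : (support w).Finite) (x : ℕ → ℝ) :
    evalPPF B.ppf2 x w = B.G.eval (fun a => spEval (B.bpoly a) x) w := by
  rw [B.G.eval_eq_slotSum hw]
  unfold ppf2
  dsimp only
  rw [evalPPF_flatMap, ← List.ofFn_eq_map, List.sum_ofFn]
  refine Finset.sum_congr rfl fun i _ => ?_
  rw [evalPPF_flatMap, ← List.ofFn_eq_map, List.sum_ofFn]
  refine Finset.sum_congr rfl fun j _ => ?_
  -- the weighted evaluation φ M := tpEval (cross M i j) w is additive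
  have hφ : ∀ M N : Mat, tpEval (B.G.crossTable (fun c d => M c d + N c d) i j) w =
      tpEval (B.G.crossTable M i j) w + tpEval (B.G.crossTable N i j) w := fun M N => B.G.tpEval_crossTable_add hw M N i j
  have hev : ∀ L : List (Mono × Mat), evalPPF (L.map fun e => (e.1, B.G.crossTable e.2 i j)) x w =
      (L.map fun e => monoVal x e.1 * tpEval (B.G.crossTable e.2 i j) w).sum := by
    intro L; unfold evalPPF; rw [List.map_map]; rfl
  rw [hev, sum_pmGroup (fun M => tpEval (B.G.crossTable M i j) w) hφ x]
  unfold slotPoly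
  rw [List.map_flatMap, sum_flatMap', ← List.ofFn_eq_map, List.sum_ofFn]
  refine Finset.sum_congr rfl fun a _ => ?_
  rw [List.map_flatMap, sum_flatMap', ← List.ofFn_eq_map, List.sum_ofFn]
  refine Finset.sum_congr rfl fun b _ => ?_
  by_cases hg : (B.G.nzGet B.G.nzTab a i && B.G.nzGet B.G.nzTab b j) = true
  · simp only [hg, if_true]
    rw [M9.get_ofMat, mat9_eq]
    by_cases hz : GramP.matIsZero (B.G.blockPair a b i j) = true
    · simp only [hz, if_true, List.map_nil, List.sum_nil]
      rw [GramP.eq_zero_of_matIsZero hz, B.G.tpEval_crossTable_zero hw]; ring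
    · have hz' : GramP.matIsZero (B.G.blockPair a b i j) = false := by simpa using hz
      have key : ∀ (Q : Mat) (L : SPoly),
          ((L.map fun e => (e.1, (fun c d => e.2 * Q c d : Mat))).map
              fun e => monoVal x e.1 * tpEval (B.G.crossTable e.2 i j) w).sum =
            spEval L x * tpEval (B.G.crossTable Q i j) w := by
        intro Q L
        induction L with
        | nil => simp [spEval]
        | cons e rest ih =>
            rw [List.map_cons, List.map_cons, List.sum_cons, ih, spEval_cons, B.G.tpEval_crossTable_smul hw]
            ring
      simp only [hz', Bool.false_eq_true, if_false]
      rw [key, spEval_spMulN]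
  · simp only [hg, Bool.false_eq_true, if_false, List.map_nil, List.sum_nil]

/-- Gram data evaluate nonnegatively (accumulated form). [folklore] -/
theorem evalPPF_ppf2_nonneg (h : B.G.weightsOK = true) {w : Label → E3} (hw : (support w).Finite) (x : ℕ → ℝ) :
    0 ≤ evalPPF B.ppf2 x w := by
  rw [B.evalPPF_ppf2 hw]; exact B.G.eval_nonneg h _ _

end GramB

/-! ## The certificate and its check -/

/-- A cell certificate: Gram data (typically one per base sublattice), box multipliers
`(variable i, half-width h, Gram datum)` for `h² − x_i² ≥ 0`, link multipliers `(link polynomial, table)`, and window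
multipliers `(ℓ, Gram datum)` for polynomials `ℓ` that are nonnegative on the cell (supplied and justified by the caller). -/
structure CellCert where
  /-- Gram data -/
  grams : List GramB
  /-- box multipliers -/
  boxes : List (ℕ × ℚ × GramB)
  /-- link multipliers `(link polynomial, polynomial table)` -/
  links : List (SPoly × PolyPF)
  /-- window multipliers -/
  wins : List (SPoly × GramB)

/-- the box polynomial `h² − x_i²` -/
def boxPoly (i : ℕ) (h : ℚ) : SPoly := [([], h * h), ([i, i], -1)]

/-- value of the box polynomial. [folklore] -/
theorem spEval_boxPoly (i : ℕ) (h : ℚ) (x : ℕ → ℝ) : spEval (boxPoly i h) x = (h : ℝ) ^ 2 - x i ^ 2 := by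
  simp [spEval, boxPoly, monoVal]; ring

/-- the polynomial pair form certified nonnegative by the certificate -/
def CellCert.ppf (C : CellCert) : PolyPF :=
  (C.grams.flatMap GramB.ppf2) ++
    (C.boxes.flatMap fun b => mulSP (boxPoly b.1 b.2.1) b.2.2.ppf2) ++
      (C.links.flatMap fun l => mulSP l.1 l.2) ++
        (C.wins.flatMap fun e => mulSP e.1 e.2.ppf2)

/-- all Gram weights of the certificate are nonnegative -/
def CellCert.wellFormed (C : CellCert) : Bool :=
  (C.grams.all fun B => B.G.weightsOK) && (C.boxes.all fun b => b.2.2.G.weightsOK) &&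
    (C.wins.all fun e => e.2.G.weightsOK)

/-- **the certified form is nonnegative** at every parameter value in the box where the links vanish and the
window polynomials are nonnegative. [folklore] -/
theorem CellCert.ppf_nonneg {C : CellCert} (hC : C.wellFormed = true) (x : ℕ → ℝ)
    (hbox : ∀ b ∈ C.boxes, |x b.1| ≤ (b.2.1 : ℝ)) (hlinks : ∀ l ∈ C.links, spEval l.1 x = 0)
    (hwins : ∀ e ∈ C.wins, 0 ≤ spEval e.1 x) {w : Label → E3} (hw : (support w).Finite) :
    0 ≤ evalPPF C.ppf x w := by
  unfold CellCert.wellFormed at hC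
  simp only [Bool.and_eq_true, List.all_eq_true] at hC
  obtain ⟨⟨hgw, hbw⟩, hww⟩ := hC
  unfold CellCert.ppf
  rw [evalPPF_append, evalPPF_append, evalPPF_append]
  refine add_nonneg (add_nonneg (add_nonneg ?_ ?_) ?_) ?_
  · rw [evalPPF_flatMap]
    exact List.sum_nonneg fun v hv => by
      obtain ⟨B, hB, rfl⟩ := List.mem_map.mp hv
      exact B.evalPPF_ppf2_nonneg (hgw B hB) hw x
  · rw [evalPPF_flatMap]
    exact List.sum_nonneg fun v hv => by
      obtain ⟨b, hb, rfl⟩ := List.mem_map.mp hv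
      rw [evalPPF_mulSP, spEval_boxPoly]
      refine mul_nonneg ?_ (b.2.2.evalPPF_ppf2_nonneg (hbw b hb) hw x)
      have := hbox b hb
      have h1 : x b.1 ^ 2 ≤ (b.2.1 : ℝ) ^ 2 := by
        rw [← sq_abs (x b.1)]
        exact pow_le_pow_left₀ (abs_nonneg _) this 2
      linarith
  · rw [evalPPF_flatMap]
    refine le_of_eq ?_
    symm
    refine List.sum_eq_zero fun v hv => ?_
    obtain ⟨l, hl, rfl⟩ := List.mem_map.mp hv
    rw [evalPPF_mulSP, hlinks l hl, zero_mul]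
  · rw [evalPPF_flatMap]
    exact List.sum_nonneg fun v hv => by
      obtain ⟨e, he, rfl⟩ := List.mem_map.mp hv
      rw [evalPPF_mulSP]
      exact mul_nonneg (hwins e he) (e.2.evalPPF_ppf2_nonneg (hww e he) hw x)

/-- merge adjacent elements with equal monomials (tables concatenated; input meant to be sorted by monomial) -/
def mergeAdjPM : PolyPF → PolyPF
  | [] => []
  | [e] => [e]
  | e :: f :: rest => if e.1 = f.1 then mergeAdjPM ((e.1, e.2 ++ f.2) :: rest) else e :: mergeAdjPM (f :: rest)
  termination_by P => P.length

/-- group a polynomial pair form by monomial: sort by monomial, merge adjacent (`O(n log n)`) -/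
def groupPM (P : PolyPF) : PolyPF := mergeAdjPM (P.mergeSort fun a b => monoLE a.1 b.1)

/-- merging adjacent equal monomials preserves evaluation. [folklore] -/
theorem evalPPF_mergeAdjPM (P : PolyPF) (x : ℕ → ℝ) (w : Label → E3) : evalPPF (mergeAdjPM P) x w = evalPPF P x w := by
  induction hn : P.length using Nat.strong_induction_on generalizing P with
  | _ n ih =>
    match P, hn with
    | [], _ => simp [mergeAdjPM]
    | [e], _ => simp [mergeAdjPM]
    | e :: f :: rest, hn =>
        rw [mergeAdjPM]
        split_ifs with h
        · rw [ih _ (by simp at hn ⊢; omega) _ rfl, evalPPF_cons, evalPPF_cons, evalPPF_cons, tpEval_append]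
          obtain ⟨me, Te⟩ := e
          obtain ⟨mf, Tf⟩ := f
          simp only at h
          subst h
          ring
        · rw [evalPPF_cons, evalPPF_cons, ih _ (by simp at hn ⊢; omega) _ rfl, evalPPF_cons]

/-- grouping by monomial preserves evaluation. [folklore] -/
theorem evalPPF_groupPM (P : PolyPF) (x : ℕ → ℝ) (w : Label → E3) : evalPPF (groupPM P) x w = evalPPF P x w := by
  unfold groupPM
  rw [evalPPF_mergeAdjPM]
  unfold evalPPF
  exact ((List.mergeSort_perm _ _).map _).sum_eq

/-- a table is identically zero after canonicalisation -/
def isZeroT (T : TPTable) : Bool := (canon3 T).all fun e => decide (∀ a b : Fin 3, e.2 a b = 0)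

/-- a table with vanishing canonical form evaluates to zero. [folklore] -/
theorem tpEval_eq_zero_of_isZeroT {w : Label → E3} (hw : (support w).Finite) {T : TPTable} (h : isZeroT T = true) :
    tpEval T w = 0 := by
  rw [← tpEval_canon3 hw T]
  unfold isZeroT at h
  rw [List.all_eq_true] at h
  generalize canon3 T = L at h ⊢
  induction L with
  | nil => rfl
  | cons e rest ih =>
      rw [tpEval_cons, ih (fun f hf => h f (List.mem_cons_of_mem _ hf))]
      have he := h e (List.mem_cons_self ..)
      simp only [decide_eq_true_eq] at he
      have : tpEntry w e = 0 := by
        simp only [tpEntry, bil, he, Rat.cast_zero, zero_mul, Finset.sum_const_zero, tsum_zero]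
      rw [this, zero_add]

/-- **THE CHECK:** the target minus the certified form vanishes identically (monomial by monomial,
as canonical two-point tables). -/
def certCheck (T : PolyPF) (C : CellCert) : Bool :=
  C.wellFormed && (groupPM (T ++ negPPF C.ppf)).all fun e => isZeroT e.2

/-- **SOUNDNESS OF THE CHECK.** If the check passes then, at every parameter value satisfying the box
constraints of the box multipliers, the link equations and the window inequalities, the target polynomial pair
form is nonnegative on every finitely supported field. -/
theorem certCheck_sound {T : PolyPF} {C : CellCert} (h : certCheck T C = true) (x : ℕ → ℝ)
    (hbox : ∀ b ∈ C.boxes, |x b.1| ≤ (b.2.1 : ℝ)) (hlinks : ∀ l ∈ C.links, spEval l.1 x = 0)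
    (hwins : ∀ e ∈ C.wins, 0 ≤ spEval e.1 x) {w : Label → E3} (hw : (support w).Finite) :
    0 ≤ evalPPF T x w := by
  unfold certCheck at h
  simp only [Bool.and_eq_true] at h
  obtain ⟨hC, h⟩ := h
  -- the identity
  have hzero : evalPPF (T ++ negPPF C.ppf) x w = 0 := by
    rw [← evalPPF_groupPM]
    rw [List.all_eq_true] at h
    generalize groupPM (T ++ negPPF C.ppf) = L at h ⊢
    induction L with
    | nil => rfl
    | cons e rest ih =>
        rw [evalPPF_cons, ih (fun f hf => h f (List.mem_cons_of_mem _ hf)),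
          tpEval_eq_zero_of_isZeroT hw (h e (List.mem_cons_self ..))]
        ring
  rw [evalPPF_append, evalPPF_negPPF] at hzero
  have hid : evalPPF T x w = evalPPF C.ppf x w := by linarith
  rw [hid]
  exact C.ppf_nonneg hC x hbox hlinks hwins hw


/-- Anchor of this support file (registered stub of the line skeleton). -/
theorem stub_certPoly : ∀ (T : PolyPF) (C : CellCert), certCheck T C = true → ∀ x : ℕ → ℝ,
    (∀ b ∈ C.boxes, |x b.1| ≤ (b.2.1 : ℝ)) → (∀ l ∈ C.links, spEval l.1 x = 0) →
    (∀ e ∈ C.wins, 0 ≤ spEval e.1 x) →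
    ∀ w : Label → EuclideanSpace ℝ (Fin 3), (Function.support w).Finite → 0 ≤ evalPPF T x w :=
  fun _ _ h x hbox hlinks hwins _ hw => certCheck_sound h x hbox hlinks hwins hw

end Summit.AtomisticToContinuum.Crystallization.Theorems.PhononStabilityCWC.Cert

end
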